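/-
COR-CM (cells pub-hodgecm / pub-hodgecm2, stage 2 of the Hodge ladder) — junction B01, item (vi) S2 pinning lane: CARRIERS-PLAN
(`hodge-director/CARRIERS-PLAN.md` v1.8, COORDINATOR RULING 2026-08-22T01:02:39Z «HODGE S-LANE: CARRIERS PLAN») §1 ROW 3 — the
posited predicate `iso : ∀ F ι₁ V Φ, ℕ → Prop` of the END display of record (`Transposition/Item6SupplyPinnedAssemblyAlongHoldsRestOne.lean`
p317049, §2 :225), i.e. [Liu2021] §4.2 l. 2055 «the hermitian space `𝕍 ⊗_𝔸 ℚ_p` is isotropic» — `Sec42Data`'s second parameter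
(`Liu2021/AppendixC/Glue.lean` :353/:361, read ONLY in the projectivity clause `isProjectiveOver_Sh_iff`, i.e. at `d = [F⁺:ℚ] = 1`) —
AS A DEFINED TREE OBJECT instead of a free binder.  For the honest Prop-C.5 datum `Model.honestP5Of h F ι₁ V Φ` (TEAM hComp,
`HComp/HonestP5Of.lean`) the finite part of the incoherent space `𝕍` IS `V ⊗_F 𝔸_F^∞` (`fix := refl`, `G := ↥V.adelicFin`), so
`𝕍 ⊗_𝔸 ℚ_p = V ⊗_ℚ ℚ_p = (L ⊗_ℚ ℚ_p)³` with the Gram matrix `V.Hm` extended `ℚ_p`-linearly and the conjugation `c ⊗ id`.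
Seat prover-pub-hodgecm-own-htheta-g5-0 (own-htheta gen 5, S2-CRUX owner; rule-(1) blanket `Transposition/Item6*`; no other seat holds
row 3).  Three `def`s (no `Classical.choice` beyond Mathlib's, no new mathematics) + theorems; no instance, no named fact, no `sorry`; no
other lane's file is modified.  HC_CM is NOT proved; S2 is NOT closed; this discharges NO displayed hypothesis — it lets the next re-cut
SPECIALISE the data binder `iso` to `Model.isoOf` (posited data −1, no new hypothesis, no cite), and records that under the face guard
`6 ≤ [F:ℚ]` every `Sec42Data` over it is in Liu's Compact Case WHATEVER the predicate says (honest by construction, inert by the guard).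
-/
import Summits.HodgeConjecture.CorCM.CM.Basic
import Literature.NumberTheory.Automorphic.Liu2021.AppendixC.Glue
import Mathlib.NumberTheory.Padics.PadicNumbers
import Mathlib.RingTheory.TensorProduct.Basic
import Mathlib.Algebra.Algebra.Rat
import HarnessLib

/-!
# `𝕍 ⊗_𝔸 ℚ_p` is isotropic — the predicate `iso` of the S2 END display, DEFINED (CARRIERS-PLAN §1 row 3)

For a hermitian 3-space `V` over the CM field `L` (Gram matrix `V.Hm`, conjugation `cmConjRingHom L`) and a prime `p`:

* `HermSpace3.padicConj L p : L ⊗[ℚ] ℚ_[p] →ₐ[ℚ] L ⊗[ℚ] ℚ_[p]` — the involution `c ⊗ id` of `L ⊗_ℚ ℚ_p = ∏_{w ∣ p} L_w`;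
* `HermSpace3.IsIsotropicAt V p` (`[Fact p.Prime]`) — «`V ⊗_ℚ ℚ_p` is isotropic»: a non-zero `v ∈ (L ⊗_ℚ ℚ_p)³` with `⟪v, v⟫ = 0` for the
  tree's sesquilinear form `hermForm` ([BMM16] Part 2 §1.1 currency, `UnitaryBallQuotientDatum.lean` :85) of the Gram matrix `V.Hm ⊗ 1`;
* `HermSpace3.isotropicAt V : ℕ → Prop` — the same on all naturals (`False` off the primes), and
  `Model.isoOf : ∀ (F : CMField) (ι₁ : F →+* ℂ) (V : HermSpace3 F ι₁) (Φ : CMType F), ℕ → Prop` — the END-display-shaped family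
  (`Φ` unused by design: the binder shape of p317049 :225 / `Sec42Data (honestP5Of h F ι₁ V Φ) (iso F ι₁ V Φ)`);
* sanity: `map_hermForm_of_comp` (change of rings for `hermForm`), `IsIsotropicAt.of_isotropic` (a GLOBAL isotropic vector is isotropic at
  every prime — the definition is not vacuous: at `[L:ℚ] = 2` the tree's `V.Hm` may be isotropic), `isotropicAt_iff`,
  `not_isotropicAt_of_not_prime`;
* the reading, stated not hidden: `Sec42Data.isNoncompactCase_iff_of_three_le` — at rank `3 ≤ n` (the tree's `honestP5` / `honestP5Of`
  have `n := 3`, `HComp/HonestP5.lean` :208, `honestP5_n`) the Noncompact Case is `d = 1` WHATEVER the predicate says: the `iso` slot sits behind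
  `n = 2` and is never reached ([Liu2021] §4.2 l. 2055; pin-1's `Model.isProjectiveOver_punctured_Sh_iff`, `HComp/HonestP5OfNonVacuityAll.lean`
  :157, is the same observation at `d = 1`); and `Sec42Data.isCompactCase_of_six_le` — under the face guard `6 ≤ [F:ℚ]` (`[F⁺:ℚ] ≠ 1`) EVERY
  `C : Sec42Data P5 (isoOf F ι₁ V Φ)`, over any `P5 : PropC5Data F⁺ F` of any rank, is in the Compact Case (l. 2057).  So `isoOf` is honest by
  construction and inert on the face path — a DEFINED datum replacing a free binder, not a discharge of anything.
HC_CM is NOT proved.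

References: Y. Liu, arXiv:2102.11518 = Camb. J. Math. 9 (2021) (`FJcycle.tex` md5 6db49a74122d), §4.2 l. 2053–2060, App. C Def. C.3–C.4
l. 4614–4624; N. Bergeron, J. Millson, C. Moeglin, *Hodge type theorems for arithmetic manifolds associated to orthogonal groups* /
ball quotients (2016), Part 2 §1.1 (the form conjugate-linear in the first variable).
-/

noncomputable section

set_option autoImplicit false

open scoped TensorProduct

namespace Summit.HodgeConjecture.CorCM

open NumberField
open Literature.NumberTheory.Automorphic (cmConjRingHom)
open Literature.AlgebraicGeometry.ShimuraVarieties (hermForm)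
open Literature.AlgebraicGeometry.Motives (CMType)

/-! ## §0  Change of rings for the tree's `hermForm` -/

/-- **Change of rings for `hermForm`.**  A ring homomorphism `τ : R → S` intertwining two involutions (`τ ∘ σ = σ' ∘ τ`) carries the
sesquilinear form with Gram matrix `H` to the one with Gram matrix `H.map τ`: `τ ⟪u, v⟫_H = ⟪τ ∘ u, τ ∘ v⟫_{H^τ}` (the tree's
`map_hermForm` is the case `S = ℂ`, `σ' = conj`). [cite: BergeronMillsonMoeglin2016Balls, Part 2 §1.1] -/
theorem map_hermForm_of_comp {R S : Type*} [CommRing R] [CommRing S] {m : Type*} [Fintype m] {σ : R →+* R} {σ' : S →+* S}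
    (τ : R →+* S) (hτ : ∀ x, τ (σ x) = σ' (τ x)) (H : Matrix m m R) (u v : m → R) :
    τ (hermForm σ H u v) = hermForm σ' (H.map τ) (τ ∘ u) (τ ∘ v) := by
  simp only [hermForm, dotProduct, Matrix.mulVec, Function.comp_apply, map_sum, map_mul, hτ, Matrix.map_apply]

namespace HermSpace3

variable {L : CMField} {ι₁ : L →+* ℂ}

/-! ## §1  `L ⊗_ℚ ℚ_p` with its conjugation, and «`V ⊗_ℚ ℚ_p` is isotropic» -/

/-- The conjugation `c ⊗ id` of `L ⊗_ℚ ℚ_p` (`c = cmConjRingHom L`, the CM conjugation of `L`), a `ℚ`-algebra endomorphism — the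
involution «induced» on `𝕍 ⊗_𝔸 ℚ_p` ([Liu2021] Def. C.3 l. 4614–4616, at the place `p`). [cite: Liu2021, App. C Def. C.3 (l. 4614–4616)] -/
def padicConj (L : CMField) (p : ℕ) [Fact p.Prime] : L ⊗[ℚ] ℚ_[p] →ₐ[ℚ] L ⊗[ℚ] ℚ_[p] :=
  Algebra.TensorProduct.map (cmConjRingHom L).toRatAlgHom (AlgHom.id ℚ ℚ_[p])

/-- `(c ⊗ id) (x ⊗ a) = c x ⊗ a`. [folklore] -/
@[simp] theorem padicConj_tmul (p : ℕ) [Fact p.Prime] (x : L) (a : ℚ_[p]) :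
    padicConj L p (x ⊗ₜ a) = cmConjRingHom L x ⊗ₜ a := by
  simp [padicConj]

/-- `c ⊗ id` extends `c` along `x ↦ x ⊗ 1`. [folklore] -/
theorem padicConj_includeLeft (p : ℕ) [Fact p.Prime] (x : L) :
    (padicConj L p : L ⊗[ℚ] ℚ_[p] →+* L ⊗[ℚ] ℚ_[p]) ((Algebra.TensorProduct.includeLeft : L →ₐ[ℚ] L ⊗[ℚ] ℚ_[p]) x) =
      (Algebra.TensorProduct.includeLeft : L →ₐ[ℚ] L ⊗[ℚ] ℚ_[p]) (cmConjRingHom L x) := by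
  simp [Algebra.TensorProduct.includeLeft_apply]

/-- **«The hermitian space `𝕍 ⊗_𝔸 ℚ_p` is isotropic»** ([Liu2021] §4.2 l. 2055) for the tree's hermitian 3-space `V` at a prime `p`:
there is a non-zero vector `v ∈ (L ⊗_ℚ ℚ_p)³` with `⟪v, v⟫ = 0`, where `⟪ , ⟫` is the sesquilinear form (conjugate-linear in the first
variable, `hermForm`) of the Gram matrix `V.Hm ⊗ 1` for the conjugation `c ⊗ id`.  (`𝕍 ⊗_𝔸 ℚ_p = V ⊗_ℚ ℚ_p` because the finite part of
the incoherent `𝕍` is `V ⊗_F 𝔸_F^∞`, Def. C.4 / l. 4624 — `fix := refl` in `Model.honestP5Of`.) [cite: Liu2021, §4.2 l. 2055 and App. C l. 4620–4624] -/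
def IsIsotropicAt (V : HermSpace3 L ι₁) (p : ℕ) [Fact p.Prime] : Prop :=
  ∃ v : Fin 3 → L ⊗[ℚ] ℚ_[p], v ≠ 0 ∧
    hermForm (padicConj L p : L ⊗[ℚ] ℚ_[p] →+* L ⊗[ℚ] ℚ_[p])
      (V.Hm.map (Algebra.TensorProduct.includeLeft : L →ₐ[ℚ] L ⊗[ℚ] ℚ_[p])) v v = 0

/-- **A global isotropic vector is isotropic at every prime**: if `0 ≠ v ∈ L³` has `⟪v, v⟫_{V} = 0`, then `v ⊗ 1` witnesses
`IsIsotropicAt V p` (`L → L ⊗_ℚ ℚ_p` is injective, `ℚ → ℚ_p` being an injection of fields).  Non-vacuity of the definition. [folklore] -/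
theorem IsIsotropicAt.of_isotropic (V : HermSpace3 L ι₁) (p : ℕ) [Fact p.Prime] {v : Fin 3 → L} (hv : v ≠ 0)
    (h0 : hermForm (cmConjRingHom L) V.Hm v v = 0) : V.IsIsotropicAt p := by
  let τ : L →ₐ[ℚ] L ⊗[ℚ] ℚ_[p] := Algebra.TensorProduct.includeLeft
  have hinj : Function.Injective τ :=
    Algebra.TensorProduct.includeLeft_injective (S := ℚ) (algebraMap ℚ ℚ_[p]).injective
  refine ⟨τ ∘ v, ?_, ?_⟩
  · intro h
    apply hv
    funext i
    exact hinj (by simpa using congrFun h i)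
  · have := map_hermForm_of_comp (σ := cmConjRingHom L) (σ' := (padicConj L p : L ⊗[ℚ] ℚ_[p] →+* L ⊗[ℚ] ℚ_[p]))
      (τ : L →+* L ⊗[ℚ] ℚ_[p]) (fun x => (padicConj_includeLeft p x).symm) V.Hm v v
    rw [h0, map_zero] at this
    exact this.symm

/-- `isotropicAt V : ℕ → Prop` — `IsIsotropicAt V p` at primes `p`, `False` elsewhere (the consumer quantifies «for every rational prime
`p`», `Glue.lean` :362). [cite: Liu2021, §4.2 l. 2055] -/
def isotropicAt (V : HermSpace3 L ι₁) (p : ℕ) : Prop :=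
  ∃ hp : p.Prime, @IsIsotropicAt L ι₁ V p ⟨hp⟩

/-- At a prime, `isotropicAt` IS `IsIsotropicAt`. [folklore] -/
theorem isotropicAt_iff (V : HermSpace3 L ι₁) (p : ℕ) [hp : Fact p.Prime] : V.isotropicAt p ↔ V.IsIsotropicAt p :=
  ⟨fun ⟨_, h⟩ => h, fun h => ⟨hp.out, h⟩⟩

/-- Off the primes the predicate is `False`. [folklore] -/
theorem not_isotropicAt_of_not_prime (V : HermSpace3 L ι₁) {p : ℕ} (hp : ¬ p.Prime) : ¬ V.isotropicAt p :=
  fun ⟨h, _⟩ => hp h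

/-- A global isotropic vector makes `V` isotropic at every prime (`IsIsotropicAt.of_isotropic`, unbundled). [folklore] -/
theorem isotropicAt_of_isotropic (V : HermSpace3 L ι₁) {v : Fin 3 → L} (hv : v ≠ 0)
    (h0 : hermForm (cmConjRingHom L) V.Hm v v = 0) (p : ℕ) (hp : p.Prime) : V.isotropicAt p :=
  ⟨hp, @IsIsotropicAt.of_isotropic L ι₁ V p ⟨hp⟩ v hv h0⟩

end HermSpace3

/-! ## §2  The END-display-shaped family `Model.isoOf` and its reading under the face guard -/

namespace Model

/-- **`iso` of the S2 END display, DEFINED**: `isoOf F ι₁ V Φ p :↔` «`𝕍 ⊗_𝔸 ℚ_p` is isotropic» for the hermitian 3-space `V` — the binder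
shape `∀ (F : CMField) (ι₁ : F →+* ℂ) (_ : HermSpace3 F ι₁) (_ : CMType F), ℕ → Prop` of p317049 :225 (the CM type is not read).
[cite: Liu2021, §4.2 l. 2055] -/
def isoOf : ∀ (F : CMField) (ι₁ : F →+* ℂ) (_ : HermSpace3 F ι₁) (_ : CMType F), ℕ → Prop :=
  fun _ _ V _ => V.isotropicAt

/-- Unfolding `isoOf`. [folklore] -/
@[simp] theorem isoOf_apply (F : CMField) (ι₁ : F →+* ℂ) (V : HermSpace3 F ι₁) (Φ : CMType F) (p : ℕ) :
    isoOf F ι₁ V Φ p = V.isotropicAt p := rfl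

end Model

/-- `[F⁺ : ℚ] ≠ 1` for a CM field with `6 ≤ [F : ℚ]` (indeed `[F:ℚ] = 2 [F⁺:ℚ]`). [folklore] -/
theorem finrank_maximalRealSubfield_ne_one (F : CMField) (h6 : 6 ≤ Module.finrank ℚ F) :
    Module.finrank ℚ (maximalRealSubfield F) ≠ 1 := by
  intro h1
  have h := Module.finrank_mul_finrank ℚ (maximalRealSubfield F) F
  rw [Algebra.IsQuadraticExtension.finrank_eq_two (maximalRealSubfield F) F, h1] at h
  omega

open Literature.NumberTheory.Automorphic.Liu2021.AppendixC in
/-- **The reading at rank `≥ 3`.**  For a standing datum of rank `3 ≤ n` — the tree's `honestP5 V K₀ M` / `Model.honestP5Of h F ι₁ V Φ` have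
`n := 3` (`honestP5_n`, by `rfl`) — the Noncompact Case of [Liu2021] §4.2 l. 2055 is EXACTLY `d = [F⁺:ℚ] = 1`, for every value of the
isotropy predicate: the clause «`n = 2` and `𝕍 ⊗_𝔸 ℚ_p` isotropic for every `p`» is never reached (pin-1's `Model.isProjectiveOver_punctured_Sh_iff`
reads the same at `d = 1`).  Hence `isoOf` is never READ by `Sec42Data.isProjectiveOver_Sh_iff` at the tree's rank-3 data, at any `d`.
[cite: Liu2021, §4.2 l. 2053–2060] -/
theorem Sec42Data.isNoncompactCase_iff_of_three_le {F₀ E : Type} [Field F₀] [NumberField F₀] [IsTotallyReal F₀] [Field E] [NumberField E]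
    [Algebra F₀ E] [IsTotallyComplex E] [Algebra.IsQuadraticExtension F₀ E] {P5 : PropC5Data F₀ E} {isotropicAt : ℕ → Prop}
    (C : Sec42Data P5 isotropicAt) (h3 : 3 ≤ P5.n) : C.IsNoncompactCase ↔ Module.finrank ℚ F₀ = 1 :=
  ⟨fun h => h.1, fun h => ⟨h, Or.inl h3⟩⟩

open Literature.NumberTheory.Automorphic.Liu2021.AppendixC in
/-- **The reading under the face guard.**  For `6 ≤ [F:ℚ]` every standing datum `C : Sec42Data P5 (isoOf F ι₁ V Φ)` — over ANY Prop-C.5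
datum `P5` for `F/F⁺`, in particular `Model.honestP5Of h F ι₁ V Φ` — is in the Compact Case ([Liu2021] §4.2 l. 2057: `d = [F⁺:ℚ] ≠ 1`
excludes the Noncompact Case), so the projectivity clause never reads `isoOf` on the face path: the predicate is honest by construction
and inert by the guard. [cite: Liu2021, §4.2 l. 2053–2060] -/
theorem Sec42Data.isCompactCase_of_six_le {F : CMField} (ι₁ : F →+* ℂ) (V : HermSpace3 F ι₁) (Φ : CMType F)
    {P5 : PropC5Data (maximalRealSubfield F) F} (C : Sec42Data P5 (Model.isoOf F ι₁ V Φ)) (h6 : 6 ≤ Module.finrank ℚ F) :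
    C.IsCompactCase :=
  fun h => finrank_maximalRealSubfield_ne_one F h6 h.1

end Summit.HodgeConjecture.CorCM

end
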